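/-
Copyright: rh-split cell (dbn column, prover seat l19-w2) gen 0, 2026-08-27.  LINE 3 «two-ray Laguerre
squeeze» of ideator rh-idea-2 (D-0145).  The linear-factor ray is an RH-STRENGTHENING conjunct; this is a
CONDITIONAL certificate GIVEN the ray.  Nothing here bears on the truth of RH.
-/
import Summits.RiemannHypothesis.RiemannHypothesis.Theorems.Splittings.LinearRayZeroSigns
import Summits.RiemannHypothesis.RiemannHypothesis.Theses.DBN
import HarnessLib

/-!
# Route `DBN` — item `LinearRayMirrorSqueeze` PROVED (the route decl by name)

`LinearRayMirrorSqueeze`: for every `a > 0`, GIVEN the ray `HasOnlyRealZeros (linearFactorH a)`, at every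
simple real zero `x` of `H_0` the two mirror members take weakly opposite signs,
`Re linearFactorH a (x) · Re linearFactorH (−a) (x) ≤ 0`.  The substance is
`Splittings.LinearRayZeroSigns.linearRayMirrorSqueeze` (two one-point Laguerre sign rules from
`LinearRayTwoPoint.laguerre_rayG` for `a` and `−a`, the ODE `deriv_rayG`, and
`hasOnlyRealZeros_linearFactorH_neg_iff`); this file only restates it as the route decl.

Support item of LINE 3 (its use is the swing lemma `DBN.LinearRaySwingLemma`); the ray is RH-strengthening
(`LinearRayTwoPoint.riemannHypothesis_of_linearRay`), so this is conditional bookkeeping on the negative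
side of the ladder.  RH is not proved by this; nothing here bears on the truth of RH.  No `sorry`, no new
axioms, no instances, no notation, no definitions.
-/

set_option linter.dupNamespace false  -- the mandated namespace repeats `RiemannHypothesis`

namespace Summit.RiemannHypothesis.RiemannHypothesis.Theorems.Splittings.LinearRayZeroSigns

/-- **Item `LinearRayMirrorSqueeze` of route `DBN` (stmt-RiemannHypothesis-22359) — PROVED** (the route decl
by name, from `linearRayMirrorSqueeze`). -/
theorem linearRayMirrorSqueeze_proof :
    Summit.RiemannHypothesis.RiemannHypothesis.Theses.DBN.LinearRayMirrorSqueeze :=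
  fun _ ha h _ hx hx' ↦ linearRayMirrorSqueeze ha h hx hx'

end Summit.RiemannHypothesis.RiemannHypothesis.Theorems.Splittings.LinearRayZeroSigns
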